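import Mathlib
import Summits.NavierStokesRegularity.NavierStokesRegularity.Theorems.WakeRatchetAdmissibleEternalBoundCritical
import HarnessLib

/-!
# Critical variables WITH COVARIANT VISCOSITY: the viscous renormalised lattice as an AUTONOMOUS
# lattice in physical time, and RE-CENTRING of the blow-up time for `IsEternalVisc`
# (support for `WakeRatchet.AdmissibleEternalBound`, stmt-NavierStokesRegularity-23197)

MODEL lattice ODEs only (Tao 2016 §4, §6.4); nothing in this file is a statement about the
Navier–Stokes equations, and no summit or rung is proved by it.

The companion file `WakeRatchetAdmissibleEternalBoundCritical` treats the inviscid class `IsEternal`.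
Here the same two facts are recorded for the VISCOUS class `IsEternalVisc ε₀ ν̂ α W` (covariant
renormalised viscosity `ν̂ (1+ε₀)^{2n} e^{-σ}`):

* (tree, `WakeRatchetTerminal.hasDerivAt_crit_visc`) with `t = -e^{-σ} < 0` and
  `V_n(t) := e^{σ} W_n(σ) = (-t)⁻¹ W_n(-log(-t))` the viscous law becomes the AUTONOMOUS lattice
  `V̇_n = Q(V_n) + Λ A(V_{n-1}) + Λ⁻¹ B(V_{n+1}, V_n) - ν̂ (1+ε₀)^{2n} V_n` on `t < 0` — Tao's viscous
  cascade in the amplitude-rescaled variables `V_n = Λ^n X_n`; the clock factor `e^{-σ}` of the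
  covariant viscosity is exactly absorbed;
* `isEternalVisc_recentre` (this file): conversely, ANY shell-wise solution `U` of that autonomous viscous
  lattice on `t < 1` with `∫_{t<1}‖U_n‖ ≤ M` and `U_n` bounded near `1⁻` gives the admissible viscous
  eternal solution `W'_n(σ) = e^{-σ} U_n(1 - e^{-σ})` with the SAME `ν̂` (blow-up time re-centred at
  `t⋆ = 1`).

So, as in the inviscid case, the renormalisation centre is invisible in the critical variables, for
every `ν̂ ≥ 0`; this is the mechanism behind the negative lemma
`WakeRatchetAdmissibleEternalBound/Negative/AdmissibleEternalBoundFalseOfGlobalSelfSimilarProfiles`.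
-/

noncomputable section

set_option linter.dupNamespace false

namespace Summit.NavierStokesRegularity.NavierStokesRegularity.Theorems

namespace WakeRatchetCriticalVisc

open Filter Topology MeasureTheory Set
open scoped RealInnerProductSpace
open Literature.Analysis.FluidPDE Literature.Analysis.FluidPDE.TaoCascade
open WakeRatchetCritical

variable {m : ℕ}

/-! ## Re-centring with covariant viscosity -/

/-- **Re-centring the renormalisation, viscous class.**  Let `U : ℤ → ℝ → Em m` solve the
autonomous viscous lattice `U̇_n = Q(U_n) + Λ A(U_{n-1}) + Λ⁻¹ B(U_{n+1}, U_n) - ν̂ (1+ε₀)^{2n} U_n` at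
every `t < 1` (`ν̂ ≥ 0`), with `∫_{t<1} ‖U_n‖ ≤ M` for all `n` and every `U_n` bounded on `[1/2, 1)`.
Then `W'_n(σ) := e^{-σ} • U_n(1 - e^{-σ})` is an admissible viscous eternal solution with the SAME
covariant viscosity coefficient `ν̂` (`IsEternalVisc ε₀ ν̂ α W'`, blow-up time re-centred at `t⋆ = 1`):
the clock factor `e^{-σ}` of the covariant viscosity is produced by the chain rule.
[cite: Tao2016AveragedNS, §4, the viscous equation before Thm. 4.2, Lemma 4.1 (4.8), §6.4; cell vocabulary (`IsEternalVisc`)] -/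
theorem isEternalVisc_recentre {ε₀ νh : ℝ} {α : Fin m → Fin m → Fin m → ℤ × ℤ × ℤ → ℝ}
    {U : ℤ → ℝ → Em m} {M : ℝ} (hν : 0 ≤ νh)
    (hU : ∀ (n : ℤ) (t : ℝ), t < 1 → HasDerivAt (U n)
      (tableQ α (U n t) + bigLam ε₀ • tableA α (U (n - 1) t)
        + (bigLam ε₀)⁻¹ • tableB α (U (n + 1) t) (U n t)
        - (νh * (1 + ε₀) ^ ((2 : ℝ) * n)) • U n t) t)
    (hint : ∀ n : ℤ, IntegrableOn (fun t => ‖U n t‖) (Iio 1) ∧ ∫ t in Iio 1, ‖U n t‖ ≤ M)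
    (hbd : ∀ n : ℤ, ∃ P : ℝ, ∀ t : ℝ, 1 / 2 ≤ t → t < 1 → ‖U n t‖ ≤ P) :
    IsEternalVisc ε₀ νh α (fun n σ => Real.exp (-σ) • U n (1 - Real.exp (-σ))) := by
  refine ⟨fun n σ => ?_, hν, ⟨M, fun n => ?_⟩, fun n => ?_⟩
  · -- the law: chain rule through `t = 1 - e^{-σ}` and homogeneity
    have hlt : 1 - Real.exp (-σ) < 1 := sub_lt_self _ (Real.exp_pos _)
    have hexp : HasDerivAt (fun s : ℝ => Real.exp (-s)) (-Real.exp (-σ)) σ := by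
      have h1 : HasDerivAt (fun s : ℝ => Real.exp (-s)) (Real.exp (-σ) * (-1)) σ :=
        (Real.hasDerivAt_exp (-σ)).comp σ ((hasDerivAt_id σ).neg)
      convert h1 using 1; ring
    have hcomp := (hU n _ hlt).scomp σ (hasDerivAt_sub_exp_neg 1 σ)
    have hder := hexp.smul hcomp
    refine hder.congr_deriv ?_
    simp only [Function.comp_apply, tableQ_smul, tableA_smul, tableB_smul_smul, smul_add, smul_sub,
      smul_smul, neg_smul]
    module
  · -- the action: change of variables
    have h := integrable_recentre_iff (U n) 1
    exact ⟨h.1.2 (hint n).1, by rw [h.2 (hint n).1]; exact (hint n).2⟩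
  · -- the forward bound: `e^{2σ} ‖W'_n(σ)‖² = ‖U_n(1 - e^{-σ})‖²`, bounded for `σ ≥ log 2`
    obtain ⟨P, hP⟩ := hbd n
    refine ⟨Real.log 2, P ^ 2, fun σ hσ => ?_⟩
    have hle : Real.exp (-σ) ≤ 1 / 2 := by
      have h1 : Real.exp (-σ) ≤ Real.exp (-Real.log 2) := Real.exp_le_exp.2 (by linarith)
      have h2 : Real.exp (-Real.log 2) = 1 / 2 := by
        rw [Real.exp_neg, Real.exp_log (by norm_num : (0:ℝ) < 2), one_div]
      linarith
    have ht1 : 1 / 2 ≤ 1 - Real.exp (-σ) := by linarith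
    have ht2 : 1 - Real.exp (-σ) < 1 := sub_lt_self _ (Real.exp_pos _)
    have hPt := hP _ ht1 ht2
    have hw : Real.exp (2 * σ) * ‖Real.exp (-σ) • U n (1 - Real.exp (-σ))‖ ^ 2
        = ‖U n (1 - Real.exp (-σ))‖ ^ 2 := by
      rw [norm_smul, Real.norm_eq_abs, abs_of_pos (Real.exp_pos _), mul_pow, ← mul_assoc,
        ← Real.exp_nat_mul, ← Real.exp_add]
      have : (2 : ℝ) * σ + ((2 : ℕ) : ℝ) * -σ = 0 := by push_cast; ring
      rw [this, Real.exp_zero, one_mul]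
    rw [hw]
    exact pow_le_pow_left₀ (norm_nonneg _) hPt 2

end WakeRatchetCriticalVisc

end Summit.NavierStokesRegularity.NavierStokesRegularity.Theorems
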